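import Summits.ResolutionOfSingularities.ResolutionOfSingularities.Theorems.RadicialJungCleanModelsGiraudChartPrimes
import Mathlib.RingTheory.Ideal.MinimalPrime.Noetherian
import Mathlib.RingTheory.Localization.AtPrime.Basic
import Mathlib.RingTheory.Localization.Away.Basic
import HarnessLib

/-!
# Route `RadicialJung`, crux `CleanModels` (stmt-15917): shrinking an affine chart so that the
# height-one primes over the ideal of `E(f)` are the principal primes of the boundary equations —
# T2 brick B3, step (S1e) part 2 (pure commutative algebra)

Support file (OURS) for PROGRAMME-clean-dim2 / T2 (`HOME/L/res-L0-w81-pv-2/g5/S1-SPEC.md`, piece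
S1e), line `via-clean-models` of crux `DescentPerfectToAll` (stmt-0549). Nothing here is a statement
of Hironaka's manuscript.

Setting: `A` a Noetherian domain, `𝔮₀` a prime (the closed point of the chart), `S = A_{𝔮₀}` (its
local ring), `I` an ideal of `A` (the ideal of `E(f)` on the chart) with `I·S = (∏ x_i)·S` for
elements `x_i ∈ A` generating height-one PRIMES `(x_i)S` of `S` (the branches of the strict normal
crossings divisor `E(f)` at the point). PROVED:

* `span_prod_le_iff_of_height_one` — in a domain, for a height-one prime `P`:
  `(∏ x_i) ≤ P ↔ ∃ i, P = (x_i)` when every `(x_i)` is a height-one prime;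
* `exists_not_mem_forall_height_one_le` — for `I ≠ ⊥` some `e ∉ 𝔮₀` lies in every height-one
  prime over `I` NOT contained in `𝔮₀` (the finitely many minimal primes of `I`);
* `exists_away_chart` — **the chart**: some `e ∉ 𝔮₀` such that in every localisation `T` of `A`
  away from `e`: every `(x_i)T` is a height-one prime containing `I·T`, and every height-one prime
  of `T` containing `I·T` is one of the `(x_i)T` — the hypotheses `hx`/`honly` of res-L1-s42-pv-2's
  `derivCriticalPrimes_iff_of_isLocalization_atPrime` (FILE 6) with `J(A, f)` replaced by the ideal
  of `E(f)` (`derivJacobianIdeal_le_prime_iff_vanishingIdeal_le`, part 1).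
-/

noncomputable section

set_option linter.dupNamespace false -- mandated namespace of this single-conjunct summit

open IsLocalRing

namespace Summit.ResolutionOfSingularities.ResolutionOfSingularities.Theorems.RadicialJung.CleanModels

/-! ## Height-one primes over a product of prime elements -/

/-- In a domain: a height-one prime contains `∏ x_i`, where each `(x_i)` is a height-one prime,
iff it is one of the `(x_i)`. [folklore] -/
theorem span_prod_le_iff_of_height_one {O : Type*} [CommRing O] [IsDomain O] {r : ℕ}
    (x : Fin r → O) (hx : ∀ i, (Ideal.span {x i}).IsPrime ∧ (Ideal.span {x i}).height = 1)
    (P : Ideal O) [P.IsPrime] (hP : P.height = 1) :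
    Ideal.span {∏ i, x i} ≤ P ↔ ∃ i, P = Ideal.span {x i} := by
  constructor
  · intro h
    rw [Ideal.span_singleton_le_iff_mem] at h
    obtain ⟨i, -, hi⟩ := Ideal.IsPrime.prod_mem_iff.mp h
    refine ⟨i, ?_⟩
    obtain ⟨hpr, hht⟩ := hx i
    haveI := hpr
    haveI : (Ideal.span {x i}).FiniteHeight := by
      rw [Ideal.finiteHeight_iff]; right; rw [hht]; exact ENat.coe_ne_top 1
    exact (Ideal.eq_of_le_of_height_le (I := Ideal.span {x i})
      ((Ideal.span_singleton_le_iff_mem _).mpr hi) (by rw [hP, hht])).symm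
  · rintro ⟨i, rfl⟩
    exact Ideal.span_singleton_le_span_singleton.mpr (Finset.dvd_prod_of_mem x (Finset.mem_univ i))

/-! ## Killing the height-one primes away from the point -/

/-- For an ideal `I ≠ ⊥` of a Noetherian domain and a prime `𝔮₀`: some `e ∉ 𝔮₀` lies in every
height-one prime over `I` which is NOT contained in `𝔮₀` (these are among the finitely many minimal
primes of `I`). [folklore] -/
theorem exists_not_mem_forall_height_one_le {A : Type*} [CommRing A] [IsDomain A]
    [IsNoetherianRing A] (I : Ideal A) (hI : I ≠ ⊥) (𝔮₀ : Ideal A) [𝔮₀.IsPrime] :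
    ∃ e ∉ 𝔮₀, ∀ 𝔭 : Ideal A, 𝔭.IsPrime → 𝔭.height = 1 → I ≤ 𝔭 → e ∉ 𝔭 → 𝔭 ≤ 𝔮₀ := by
  classical
  have hfin := I.finite_minimalPrimes_of_isNoetherianRing
  -- for the minimal primes not inside `𝔮₀`, an element outside `𝔮₀`
  have hch : ∀ 𝔭 ∈ hfin.toFinset, ¬ 𝔭 ≤ 𝔮₀ → ∃ a ∈ 𝔭, a ∉ 𝔮₀ := fun 𝔭 _ h =>
    Set.not_subset.mp h
  choose! a ha ha𝔮 using hch
  refine ⟨∏ 𝔭 ∈ hfin.toFinset.filter (fun 𝔭 => ¬ 𝔭 ≤ 𝔮₀), a 𝔭, fun hmem => ?_,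
    fun 𝔭 h𝔭 hht hI𝔭 he => ?_⟩
  · obtain ⟨𝔭, h𝔭, hmem⟩ := Ideal.IsPrime.prod_mem_iff.mp hmem
    rw [Finset.mem_filter] at h𝔭
    exact ha𝔮 𝔭 h𝔭.1 h𝔭.2 hmem
  · by_contra hnot
    haveI := h𝔭
    -- `𝔭` is a minimal prime of `I`: `height 𝔭 = 1 ≤ height I` as `I ≠ ⊥`
    have hIht : (1 : ℕ∞) ≤ I.height := by
      rw [Order.one_le_iff_ne_zero, Ne, Ideal.height_eq_zero_iff_eq_bot]
      exact hI
    haveI : 𝔭.FiniteHeight := by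
      rw [Ideal.finiteHeight_iff]; right; rw [hht]; exact ENat.coe_ne_top 1
    have hmin : 𝔭 ∈ I.minimalPrimes := Ideal.mem_minimalPrimes_of_height_eq hI𝔭 (by rw [hht]; exact hIht)
    have hmemF : 𝔭 ∈ hfin.toFinset.filter (fun 𝔭 => ¬ 𝔭 ≤ 𝔮₀) := by
      rw [Finset.mem_filter, Set.Finite.mem_toFinset]
      exact ⟨hmin, hnot⟩
    apply he
    obtain ⟨c, hc⟩ := Finset.dvd_prod_of_mem a hmemF
    rw [hc]
    exact Ideal.mul_mem_right _ _ (ha 𝔭 (Finset.mem_filter.mp hmemF).1 hnot)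

/-! ## The chart -/

section Chart

variable {A : Type*} [CommRing A] [IsDomain A] [IsNoetherianRing A] (𝔮₀ : Ideal A) [𝔮₀.IsPrime]
  (S : Type*) [CommRing S] [Algebra A S] [IsLocalization.AtPrime S 𝔮₀]

omit [IsDomain A] [IsNoetherianRing A] in
/-- Contraction to `A` of the prime `(x)S` of the local ring `S = A_{𝔮₀}`: a prime of `A` inside
`𝔮₀` of the same height, with `𝔭·S = (x)S`. [folklore] -/
theorem under_span_singleton_localization {x : A}
    (hx : (Ideal.span {algebraMap A S x}).IsPrime ∧ (Ideal.span {algebraMap A S x}).height = 1) :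
    ((Ideal.span {algebraMap A S x}).under A).IsPrime ∧
      ((Ideal.span {algebraMap A S x}).under A).height = 1 ∧
      (Ideal.span {algebraMap A S x}).under A ≤ 𝔮₀ ∧
      ((Ideal.span {algebraMap A S x}).under A).map (algebraMap A S) =
        Ideal.span {algebraMap A S x} ∧
      x ∈ (Ideal.span {algebraMap A S x}).under A := by
  obtain ⟨hpr, hht⟩ := hx
  haveI := hpr
  have h1 := (IsLocalization.isPrime_iff_isPrime_disjoint 𝔮₀.primeCompl S _).mp hpr
  refine ⟨h1.1, ?_, ?_, IsLocalization.map_under 𝔮₀.primeCompl S _, ?_⟩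
  · rw [IsLocalization.height_under 𝔮₀.primeCompl]; exact hht
  · intro a ha
    by_contra hnot
    exact Set.disjoint_left.mp h1.2 hnot ha
  · exact Ideal.mem_comap.mpr (Ideal.subset_span rfl)

include 𝔮₀ S in
/-- **The shrunk chart.** Let `I ≠ ⊥` with `I·S = (∏ x_i)·S` where each `(x_i)S` is a height-one
prime of `S = A_{𝔮₀}`. Then for some `e ∉ 𝔮₀` and every localisation `T` of `A` away from `e`:
every `(x_i)T` is a height-one prime of `T` containing `I·T`, and every height-one prime of `T`
containing `I·T` is one of the `(x_i)T`. [folklore] -/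
theorem exists_away_chart {I : Ideal A} (hI : I ≠ ⊥) {r : ℕ} (x : Fin r → A)
    (hx : ∀ i, (Ideal.span {algebraMap A S (x i)}).IsPrime ∧
      (Ideal.span {algebraMap A S (x i)}).height = 1)
    (hIS : I.map (algebraMap A S) = Ideal.span {algebraMap A S (∏ i, x i)}) :
    ∃ e ∉ 𝔮₀, ∀ (T : Type*) [CommRing T] [Algebra A T] [IsLocalization.Away e T],
      (∀ i, (Ideal.span {algebraMap A T (x i)}).IsPrime ∧
        (Ideal.span {algebraMap A T (x i)}).height = 1 ∧
        I.map (algebraMap A T) ≤ Ideal.span {algebraMap A T (x i)}) ∧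
      ∀ 𝔭 : Ideal T, 𝔭.IsPrime → 𝔭.height = 1 → I.map (algebraMap A T) ≤ 𝔭 →
        ∃ i, 𝔭 = Ideal.span {algebraMap A T (x i)} := by
  classical
  -- the contracted primes `𝔭_i`
  let P : Fin r → Ideal A := fun i => (Ideal.span {algebraMap A S (x i)}).under A
  have hP : ∀ i, (P i).IsPrime ∧ (P i).height = 1 ∧ P i ≤ 𝔮₀ ∧
      (P i).map (algebraMap A S) = Ideal.span {algebraMap A S (x i)} ∧ x i ∈ P i :=
    fun i => under_span_singleton_localization 𝔮₀ S (hx i)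
  -- `I ≤ P i`
  have hIP : ∀ i, I ≤ P i := by
    intro i a ha
    change algebraMap A S a ∈ Ideal.span {algebraMap A S (x i)}
    have : algebraMap A S a ∈ I.map (algebraMap A S) := Ideal.mem_map_of_mem _ ha
    rw [hIS, Ideal.mem_span_singleton] at this
    rw [Ideal.mem_span_singleton]
    exact (dvd_trans (by rw [map_prod]; exact Finset.dvd_prod_of_mem _ (Finset.mem_univ i)) this)
  -- `e₁`: principalise every `P i` away from `𝔮₀`
  have he₁ : ∀ i, ∃ e ∉ 𝔮₀,
      (P i).map (algebraMap A (Localization.Away e)) =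
        Ideal.span {algebraMap A (Localization.Away e) (x i)} := by
    intro i
    obtain ⟨e, he, h⟩ := exists_not_mem_and_map_eq_span_away 𝔮₀ S (IsNoetherian.noetherian (P i))
      (hP i).2.2.2.2 (hP i).2.2.2.1
    exact ⟨e, he, h (Localization.Away e)⟩
  choose e₁ he₁𝔮 he₁T using he₁
  -- `e₂`: kill the height-one primes over `I` away from `𝔮₀`
  obtain ⟨e₂, he₂𝔮, he₂⟩ := exists_not_mem_forall_height_one_le I hI 𝔮₀
  refine ⟨(∏ i, e₁ i) * e₂, fun hmem => ?_, fun T _ _ _ => ?_⟩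
  · rcases ‹𝔮₀.IsPrime›.mem_or_mem hmem with h | h
    · obtain ⟨i, -, hi⟩ := Ideal.IsPrime.prod_mem_iff.mp h
      exact he₁𝔮 i hi
    · exact he₂𝔮 h
  · -- each factor of `e` is a unit in `T`, so `T` is also a localisation away from each `e₁ i`:
    -- we use instead the universal property through `A → T` being a localisation at the powers of `e`
    have heT : ∀ a : A, a ∣ (∏ i, e₁ i) * e₂ → IsUnit (algebraMap A T a) := fun a ha =>
      isUnit_of_dvd_unit (map_dvd (algebraMap A T) ha) (IsLocalization.Away.algebraMap_isUnit _)
    -- the prime correspondence for `T`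
    have hdisj : ∀ 𝔭 : Ideal A, 𝔭.IsPrime → ((∏ i, e₁ i) * e₂) ∉ 𝔭 →
        Disjoint ((Submonoid.powers ((∏ i, e₁ i) * e₂) : Submonoid A) : Set A) (𝔭 : Set A) := by
      intro 𝔭 h𝔭 he
      rw [Set.disjoint_left]
      rintro a ⟨n, rfl⟩ ha
      exact he (h𝔭.mem_of_pow_mem n ha)
    -- `(P i)·T = (x i)·T`: factor `A → T` through `A[1/e₁ i] → T` (`e₁ i` is a unit in `T`)
    have hPT : ∀ i, (P i).map (algebraMap A T) = Ideal.span {algebraMap A T (x i)} := by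
      intro i
      let L := Localization.Away (e₁ i)
      have hu : IsUnit (algebraMap A T (e₁ i)) :=
        heT (e₁ i) (dvd_mul_of_dvd_left (Finset.dvd_prod_of_mem _ (Finset.mem_univ i)) _)
      let φ : L →+* T := IsLocalization.Away.lift (e₁ i) hu
      have hφ : φ.comp (algebraMap A L) = algebraMap A T := IsLocalization.Away.lift_comp (e₁ i) hu
      have hL := he₁T i
      rw [← hφ, ← Ideal.map_map, hL, Ideal.map_span, Set.image_singleton, ← RingHom.comp_apply, hφ]
    refine ⟨fun i => ?_, fun 𝔭 h𝔭 hht hI𝔭 => ?_⟩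
    · obtain ⟨hpr, hht, hle, -, -⟩ := hP i
      haveI := hpr
      have he : (∏ i, e₁ i) * e₂ ∉ P i := fun h => (by
        rcases hpr.mem_or_mem h with h | h
        · obtain ⟨j, -, hj⟩ := Ideal.IsPrime.prod_mem_iff.mp h
          exact he₁𝔮 j (hle hj)
        · exact he₂𝔮 (hle h))
      rw [← hPT i]
      refine ⟨IsLocalization.isPrime_of_isPrime_disjoint _ T (P i) hpr (hdisj (P i) hpr he), ?_,
        Ideal.map_mono (hIP i)⟩
      rw [IsLocalization.height_map_of_disjoint (Submonoid.powers ((∏ i, e₁ i) * e₂)) (P i)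
        (hdisj (P i) hpr he)]
      exact hht
    · haveI := h𝔭
      -- contract to `A`
      set 𝔭₀ := 𝔭.under A with h𝔭₀
      have h0 := (IsLocalization.isPrime_iff_isPrime_disjoint
        (Submonoid.powers ((∏ i, e₁ i) * e₂)) T 𝔭).mp h𝔭
      haveI : 𝔭₀.IsPrime := h0.1
      have hht₀ : 𝔭₀.height = 1 := by
        rw [h𝔭₀, IsLocalization.height_under (Submonoid.powers ((∏ i, e₁ i) * e₂))]; exact hht
      have hI₀ : I ≤ 𝔭₀ := fun a ha => Ideal.mem_comap.mpr (hI𝔭 (Ideal.mem_map_of_mem _ ha))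
      have he₀ : (∏ i, e₁ i) * e₂ ∉ 𝔭₀ := fun h =>
        Set.disjoint_left.mp h0.2 (Submonoid.mem_powers _) h
      have he₂₀ : e₂ ∉ 𝔭₀ := fun h => he₀ (Ideal.mul_mem_left _ _ h)
      have hle : 𝔭₀ ≤ 𝔮₀ := he₂ 𝔭₀ h0.1 hht₀ hI₀ he₂₀
      -- pass to `S = A_{𝔮₀}`: `𝔭₀ S` is a height-one prime over `(∏ x)S`
      have hdisjS : Disjoint (𝔮₀.primeCompl : Set A) (𝔭₀ : Set A) :=
        Set.disjoint_left.mpr fun a ha ha' => ha (hle ha')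
      haveI hprS : (𝔭₀.map (algebraMap A S)).IsPrime :=
        IsLocalization.isPrime_of_isPrime_disjoint _ S 𝔭₀ h0.1 hdisjS
      have hhtS : (𝔭₀.map (algebraMap A S)).height = 1 := by
        rw [IsLocalization.height_map_of_disjoint 𝔮₀.primeCompl 𝔭₀ hdisjS]; exact hht₀
      haveI : IsDomain S :=
        IsLocalization.isDomain_of_le_nonZeroDivisors (M := 𝔮₀.primeCompl) S
          (Ideal.primeCompl_le_nonZeroDivisors 𝔮₀)
      have hprod : Ideal.span {∏ i, algebraMap A S (x i)} ≤ 𝔭₀.map (algebraMap A S) := by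
        rw [← map_prod, ← hIS]; exact Ideal.map_mono hI₀
      obtain ⟨i, hi⟩ := (span_prod_le_iff_of_height_one (fun i => algebraMap A S (x i)) hx
        (𝔭₀.map (algebraMap A S)) hhtS).mp hprod
      refine ⟨i, ?_⟩
      -- `𝔭₀ = P i`, hence `𝔭 = 𝔭₀ T = (P i) T = (x i) T`
      have h𝔭₀P : 𝔭₀ = P i := by
        have h1 : (𝔭₀.map (algebraMap A S)).under A = 𝔭₀ :=
          IsLocalization.under_map_of_isPrime_disjoint 𝔮₀.primeCompl S h0.1 hdisjS
        rw [hi] at h1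
        exact h1.symm
      rw [← IsLocalization.map_under (Submonoid.powers ((∏ i, e₁ i) * e₂)) T 𝔭]
      change 𝔭₀.map (algebraMap A T) = _
      rw [h𝔭₀P, hPT i]

end Chart

end Summit.ResolutionOfSingularities.ResolutionOfSingularities.Theorems.RadicialJung.CleanModels

end
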